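import Literature.Probability.Percolation.AnnulusAlternation
import HarnessLib

/-!
# Three open crossing clusters of a hexagonal annulus force three closed crossing clusters

Crux `Summit.CriticalPhenomena.CardyFormulaZ2.Theses.CardyMagicRigidity.NestingRigidity` (stmt-CriticalPhenomena-4835),
line `pinch-resampling` v4, stub S11 `stub_neckHookupCoarseT`, input (I0) `TPinchPositive` (positivity of "exactly two
open and exactly two closed crossing clusters of the collar `Λ_{2s} ∖ Λ_s`").  The planar half of (I0): the ALTERNATION
of crossing clusters of the annulus `A = {n ≤ |·|_𝕋 ≤ N}` (`triAnn n N`, `1 ≤ n`, `n + 2 ≤ N`) beyond two clusters.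

* `TPinchPos.holeBridge`, `TPinchPos.holeBridge_open` — two (open) crossings `s_b ⇝ t_b`, `s_c ⇝ t_c` of `A` are joined, through the hole
  `Λ_{n-1}`, by a path of `Λ_N` avoiding the closed sites of `A` (the comparison path of every interleaving argument).
* `TPinchPos.mem_annComp_of_pathIn_of_mem` — the component of `A ∖ Cl(s_a)` containing `s_c` contains the whole
  open crossing from `s_c` (when `s_c` is not joined to `s_a`).
* **`TPinchPos.three_closed_of_three_open`** — three open crossings of `A` pairwise not joined by open paths of `A`
  yield three CLOSED crossings of `A` pairwise not joined by closed paths of `A`.  Proof: the frontier chains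
  `d₁ : σ₁ ⇝ τ₁`, `d₂ : τ₂ ⇝ σ₂` of `Cl(s_a)` facing `s_b` (`exists_frontierChains_alternating`, certified order
  `τ₁ < t_b < τ₂ < t_a`); if `s_c` lies in another component of `A ∖ Cl(s_a)` than `s_b`, the first frontier chain of
  `Cl(s_a)` facing `s_c` is the third crossing (components are not joined off the cluster); otherwise `t_b, t_c` both lie
  in the arc `(τ₁, τ₂)` (`annFrontier_order` (iv)) and the frontier chain of `Cl(s_b)` facing `s_c` whose tip lies
  between `t_b` and `t_c` is the third one: a closed path from its tip to `τ₁` or to `τ₂` would interleave with the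
  open-and-hole path `t_b ⇝ s_b → hole → s_c ⇝ t_c` (`triBall_not_interleaved_shift`).

Pure combinatorics of `𝕋`; no probability, no named facts.
-/

namespace Summit.CriticalPhenomena.CardyFormulaZ2.Cruxes.NestingRigidity.PinchResampling

namespace TPinchPos

open Set Literature.Probability.Percolation Literature.Probability.LatticeModels

variable {n N : ℕ} {ω : SiteConfig (Site 2)}

/-- **The hole bridge.**  Two paths `s_b ⇝ t_b`, `s_c ⇝ t_c` inside a set `X` of sites of `A = {n ≤ |·| ≤ N}`
(`1 ≤ n ≤ N`) starting on `∂Λ_n` are joined inside `Λ_N` by a path of `X ∪ Λ_{n-1}`: back along the first path, one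
step into the hole, through the hole, one step out, along the second path. -/
theorem holeBridge (hn : 1 ≤ n) (hnN : n ≤ N) {X : Set (Site 2)} (hX : X ⊆ triAnn n N) {sb tb sc tc : Site 2}
    (hBb : PathIn triGraph X sb tb) (hsb : triNorm sb = n) (hBc : PathIn triGraph X sc tc) (hsc : triNorm sc = n) :
    PathIn triGraph ((↑(triBall N) : Set (Site 2)) ∩ {z | z ∈ X ∨ triNorm z < n}) tb tc := by
  set B : Set (Site 2) := {z | z ∈ X ∨ triNorm z < n}
  have inB : ∀ {a b : Site 2}, PathIn triGraph X a b → PathIn triGraph ((↑(triBall N) : Set (Site 2)) ∩ B) a b :=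
    fun hp ↦ hp.mono fun _ hz ↦ ⟨Finset.mem_coe.2 (mem_triBall_iff.2 (mem_triAnn.1 (hX hz)).2), Or.inl hz⟩
  have holeB : ∀ z : Site 2, triNorm z < n → z ∈ (↑(triBall N) : Set (Site 2)) ∩ B := fun z hz ↦
    ⟨Finset.mem_coe.2 (mem_triBall_iff.2 (by omega)), Or.inr hz⟩
  obtain ⟨gb, hadjb, hgb⟩ := exists_adj_mem_triBall_sub_one hn hsb
  obtain ⟨gc, hadjc, hgc⟩ := exists_adj_mem_triBall_sub_one hn hsc
  have hgb' : triNorm gb < n := by have := hgb; push_cast [Nat.cast_sub hn] at this; omega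
  have hgc' : triNorm gc < n := by have := hgc; push_cast [Nat.cast_sub hn] at this; omega
  have phole : PathIn triGraph ((↑(triBall N) : Set (Site 2)) ∩ B) gb gc :=
    (pathIn_triBall hgb hgc).mono fun z hz ↦ holeB z (by
      have := mem_triBall_iff.1 (Finset.mem_coe.1 hz); push_cast [Nat.cast_sub hn] at this; omega)
  exact ((((inB hBb).symm.tail hadjb (holeB gb hgb')).trans phole).trans
    (PathIn.of_adj (holeB gc hgc') (inB hBc).left_mem hadjc.symm)).trans (inB hBc)

/-- **The open-and-hole bridge.**  Two open crossings `s_b ⇝ t_b`, `s_c ⇝ t_c` of `A` are joined inside `Λ_N` by a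
path avoiding the closed sites of `A`. -/
theorem holeBridge_open (hn : 1 ≤ n) (hnN : n ≤ N) {sb tb sc tc : Site 2}
    (hBb : PathIn triGraph (triAnn n N ∩ ω) sb tb) (hsb : triNorm sb = n)
    (hBc : PathIn triGraph (triAnn n N ∩ ω) sc tc) (hsc : triNorm sc = n) :
    PathIn triGraph ((↑(triBall N) : Set (Site 2)) ∩ (triAnn n N \ ω)ᶜ) tb tc := by
  refine (holeBridge hn hnN inter_subset_left hBb hsb hBc hsc).mono fun z hz ↦ ⟨hz.1, fun h ↦ ?_⟩
  rcases hz.2 with h' | h'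
  · exact h.2 h'.2
  · have := (mem_triAnn.1 h.1).1; omega

/-- **An open path from a site of the component stays in the component** (of `A ∖ Cl(s_a)` containing `s_b`), provided
its start is not joined to `s_a` by an open path of `A`: none of its sites lies in the cluster. -/
theorem mem_annComp_of_pathIn_of_mem {sa sb u v : Site 2} (hu : u ∈ annComp n N ω sa sb)
    (hsep : ¬ PathIn triGraph (triAnn n N ∩ ω) sa u) (hv : PathIn triGraph (triAnn n N ∩ ω) u v) :
    v ∈ annComp n N ω sa sb := by
  obtain ⟨S, hS, hp, htight⟩ := hv.exists_support
  refine hu.trans (hp.mono fun z hz ↦ ⟨(hS hz).1, fun hzCl ↦ hsep ?_⟩)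
  exact hzCl.trans ((htight z hz).mono hS).symm

/-- **Different components of `A ∖ Cl(s_a)` are not joined by closed paths of `A`** (closed sites are off the cluster,
so such a path would merge the components). -/
theorem not_pathIn_closed_of_annComp_ne {sa sb sc u u' : Site 2} (hcU : sc ∉ annComp n N ω sa sb)
    (hu : u ∈ annComp n N ω sa sb) (hu' : u' ∈ annComp n N ω sa sc) :
    ¬ PathIn triGraph (triAnn n N \ ω) u u' := by
  intro hP
  have hP' : PathIn triGraph (triAnn n N \ annCluster n N ω sa) u u' :=
    hP.mono fun _ hz ↦ ⟨hz.1, fun hzCl ↦ hz.2 (annCluster_subset hzCl).2⟩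
  exact hcU ((hu.trans hP').trans hu'.symm)

/-- Closed paths of `A` are paths of `Λ_N` inside the closed sites of `A`. -/
theorem pathIn_ball_closed {u v : Site 2} (h : PathIn triGraph (triAnn n N \ ω) u v) :
    PathIn triGraph ((↑(triBall N) : Set (Site 2)) ∩ (triAnn n N \ ω)) u v :=
  h.mono fun _ hz ↦ ⟨Finset.mem_coe.2 (mem_triBall_iff.2 (mem_triAnn.1 hz.1).2), hz⟩

/-- **Three open crossing clusters force three closed crossing clusters.**  For `1 ≤ n`, `n + 2 ≤ N` and three open
crossings `s_a ⇝ t_a`, `s_b ⇝ t_b`, `s_c ⇝ t_c` of `A = {n ≤ |·| ≤ N}` (from `∂Λ_n` to `∂Λ_N`, open paths of `A`)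
pairwise not joined by open paths of `A`, there are three closed crossings `xᵢ ⇝ yᵢ` of `A` whose outer ends are
pairwise not joined by closed paths of `A`. -/
theorem three_closed_of_three_open (hn : 1 ≤ n) (hnN : n + 2 ≤ N) {sa ta sb tb sc tc : Site 2}
    (hBa : PathIn triGraph (triAnn n N ∩ ω) sa ta) (hsa : triNorm sa = n) (hta : triNorm ta = N)
    (hBb : PathIn triGraph (triAnn n N ∩ ω) sb tb) (hsb : triNorm sb = n) (htb : triNorm tb = N)
    (hBc : PathIn triGraph (triAnn n N ∩ ω) sc tc) (hsc : triNorm sc = n) (htc : triNorm tc = N)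
    (hab : ¬ PathIn triGraph (triAnn n N ∩ ω) sa sb) (hac : ¬ PathIn triGraph (triAnn n N ∩ ω) sa sc)
    (hbc : ¬ PathIn triGraph (triAnn n N ∩ ω) sb sc) :
    ∃ x₁ y₁ x₂ y₂ x₃ y₃ : Site 2, triNorm x₁ = n ∧ triNorm y₁ = N ∧ triNorm x₂ = n ∧ triNorm y₂ = N ∧
      triNorm x₃ = n ∧ triNorm y₃ = N ∧
      PathIn triGraph (triAnn n N \ ω) x₁ y₁ ∧ PathIn triGraph (triAnn n N \ ω) x₂ y₂ ∧
      PathIn triGraph (triAnn n N \ ω) x₃ y₃ ∧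
      ¬ PathIn triGraph (triAnn n N \ ω) y₁ y₂ ∧ ¬ PathIn triGraph (triAnn n N \ ω) y₁ y₃ ∧
      ¬ PathIn triGraph (triAnn n N \ ω) y₂ y₃ := by
  have hN : 1 ≤ N := by omega
  -- the frontier chains of `Cl(s_a)` facing `s_b`
  obtain ⟨F, hnj, h0b, hb2, -⟩ := exists_frontierChains_alternating hn hnN hBa hsa hta hBb hsb htb hab
  obtain ⟨-, -, -, hIV⟩ := annFrontier_order hn hnN F
  set U := annComp n N ω sa sb with hU
  set 𝔅 : Set (Site 2) := triAnn n N \ ω with h𝔅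
  have hτ₁U : F.τ₁ ∈ U := annFrontier_subset_annComp F.chain₁.right_mem
  have hτ₂U : F.τ₂ ∈ U := annFrontier_subset_annComp F.chain₂.left_mem
  have d₁ : PathIn triGraph 𝔅 F.σ₁ F.τ₁ := F.chain₁.mono annFrontier_subset
  have d₂ : PathIn triGraph 𝔅 F.σ₂ F.τ₂ := (F.chain₂.mono annFrontier_subset).symm
  by_cases hcU : sc ∈ U
  · -- Case B: `s_c` in the component of `s_b`; then `t_b, t_c ∈ (τ₁, τ₂)`
    have hsbU : sb ∈ U := mem_annComp_of_pathIn hab (PathIn.refl hBb.left_mem)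
    have htbU : tb ∈ U := mem_annComp_of_pathIn hab hBb
    have htcU : tc ∈ U := mem_annComp_of_pathIn_of_mem hcU hac hBc
    obtain ⟨h0c, hc2⟩ := hIV tc htcU hBc.right_mem.2 htc
    have hne : tb ≠ tc := by
      rintro rfl
      exact hbc (hBb.trans hBc.symm)
    have hne' : hexShift N F.τ₁ tb ≠ hexShift N F.τ₁ tc := fun e ↦ hne (hexShift_injOn hN htb htc e)
    -- the frontier chains of `Cl(s_b)` facing `s_c`
    obtain ⟨G, -, g0c, gc2, g2b⟩ := exists_frontierChains_alternating hn hnN hBb hsb htb hBc hsc htc hbc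
    have hQ : PathIn triGraph ((↑(triBall N) : Set (Site 2)) ∩ 𝔅ᶜ) tb tc := holeBridge_open hn (by omega) hBb hsb hBc hsc
    -- ranges of the perimeter coordinates
    have rτ := hexPos_range hN F.norm_τ₁
    have rb := hexPos_range hN htb
    have rc := hexPos_range hN htc
    have rρ₁ := hexPos_range hN G.norm_τ₁
    have rρ₂ := hexPos_range hN G.norm_τ₂
    rcases lt_or_gt_of_ne hne' with hlt | hlt
    · -- `t_b < t_c`: the third crossing is `G.σ₁ ⇝ G.τ₁`, whose tip lies in `(t_b, t_c)`
      have key : hexShift N F.τ₁ tb < hexShift N F.τ₁ G.τ₁ ∧ hexShift N F.τ₁ G.τ₁ < hexShift N F.τ₁ tc := by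
        unfold hexShift at hlt g0c gc2 g2b ⊢
        split_ifs at hlt g0c gc2 g2b ⊢ <;> omega
      refine ⟨F.σ₁, F.τ₁, F.σ₂, F.τ₂, G.σ₁, G.τ₁, F.norm_σ₁, F.norm_τ₁, F.norm_σ₂, F.norm_τ₂, G.norm_σ₁,
        G.norm_τ₁, d₁, d₂, G.chain₁.mono annFrontier_subset, hnj, fun hP ↦ ?_, fun hP ↦ ?_⟩
      · exact triBall_not_interleaved_shift hN 𝔅 F.norm_τ₁ F.norm_τ₁ htb G.norm_τ₁ htc
          (by rw [hexShift_self]; exact h0b) key.1 key.2 (pathIn_ball_closed hP) hQ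
      · have hP' : PathIn triGraph ((↑(triBall N) : Set (Site 2)) ∩ 𝔅ᶜᶜ) G.τ₁ F.τ₂ := by
          rw [compl_compl]; exact pathIn_ball_closed hP.symm
        exact triBall_not_interleaved_shift hN 𝔅ᶜ F.norm_τ₁ htb G.norm_τ₁ htc F.norm_τ₂ key.1 key.2 hc2 hQ hP'
    · -- `t_c < t_b`: the third crossing is `G.σ₂ ⇝ G.τ₂`, whose tip lies in `(t_c, t_b)`
      have key : hexShift N F.τ₁ tc < hexShift N F.τ₁ G.τ₂ ∧ hexShift N F.τ₁ G.τ₂ < hexShift N F.τ₁ tb := by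
        unfold hexShift at hlt g0c gc2 g2b ⊢
        split_ifs at hlt g0c gc2 g2b ⊢ <;> omega
      refine ⟨F.σ₁, F.τ₁, F.σ₂, F.τ₂, G.σ₂, G.τ₂, F.norm_σ₁, F.norm_τ₁, F.norm_σ₂, F.norm_τ₂, G.norm_σ₂,
        G.norm_τ₂, d₁, d₂, (G.chain₂.mono annFrontier_subset).symm, hnj, fun hP ↦ ?_, fun hP ↦ ?_⟩
      · exact triBall_not_interleaved_shift hN 𝔅 F.norm_τ₁ F.norm_τ₁ htc G.norm_τ₂ htb
          (by rw [hexShift_self]; exact h0c) key.1 key.2 (pathIn_ball_closed hP) hQ.symm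
      · have hP' : PathIn triGraph ((↑(triBall N) : Set (Site 2)) ∩ 𝔅ᶜᶜ) G.τ₂ F.τ₂ := by
          rw [compl_compl]; exact pathIn_ball_closed hP.symm
        exact triBall_not_interleaved_shift hN 𝔅ᶜ F.norm_τ₁ htc G.norm_τ₂ htb F.norm_τ₂ key.1 key.2 hb2 hQ.symm hP'
  · -- Case A: `s_c` in another component; the first frontier chain of `Cl(s_a)` facing `s_c` is the third crossing
    obtain ⟨F', -, -, -, -⟩ := exists_frontierChains_alternating hn hnN hBa hsa hta hBc hsc htc hac
    have hτ₁'U' : F'.τ₁ ∈ annComp n N ω sa sc := annFrontier_subset_annComp F'.chain₁.right_mem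
    exact ⟨F.σ₁, F.τ₁, F.σ₂, F.τ₂, F'.σ₁, F'.τ₁, F.norm_σ₁, F.norm_τ₁, F.norm_σ₂, F.norm_τ₂, F'.norm_σ₁,
      F'.norm_τ₁, d₁, d₂, F'.chain₁.mono annFrontier_subset, hnj,
      not_pathIn_closed_of_annComp_ne hcU hτ₁U hτ₁'U', not_pathIn_closed_of_annComp_ne hcU hτ₂U hτ₁'U'⟩

end TPinchPos

open Literature.Probability.Percolation Literature.Probability.LatticeModels in
/-- **Anchor (stub S11 helper, input (I0)): three open crossing clusters of `{n ≤ |·|_𝕋 ≤ N}` force three closed crossing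
clusters** — `TPinchPos.three_closed_of_three_open` with all binders explicit. -/
theorem tPinch_threeClosed_of_threeOpen : ∀ (n N : ℕ) (ω : SiteConfig (Site 2)) (sa ta sb tb sc tc : Site 2), 1 ≤ n → n + 2 ≤ N → PathIn triGraph (triAnn n N ∩ ω) sa ta → triNorm sa = n → triNorm ta = N → PathIn triGraph (triAnn n N ∩ ω) sb tb → triNorm sb = n → triNorm tb = N → PathIn triGraph (triAnn n N ∩ ω) sc tc → triNorm sc = n → triNorm tc = N → ¬ PathIn triGraph (triAnn n N ∩ ω) sa sb → ¬ PathIn triGraph (triAnn n N ∩ ω) sa sc → ¬ PathIn triGraph (triAnn n N ∩ ω) sb sc → ∃ x₁ y₁ x₂ y₂ x₃ y₃ : Site 2, triNorm x₁ = n ∧ triNorm y₁ = N ∧ triNorm x₂ = n ∧ triNorm y₂ = N ∧ triNorm x₃ = n ∧ triNorm y₃ = N ∧ PathIn triGraph (triAnn n N \ ω) x₁ y₁ ∧ PathIn triGraph (triAnn n N \ ω) x₂ y₂ ∧ PathIn triGraph (triAnn n N \ ω) x₃ y₃ ∧ ¬ PathIn triGraph (triAnn n N \ ω) y₁ y₂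 ∧ ¬ PathIn triGraph (triAnn n N \ ω) y₁ y₃ ∧ ¬ PathIn triGraph (triAnn n N \ ω) y₂ y₃ :=
  fun _ _ _ _ _ _ _ _ _ hn hnN hBa hsa hta hBb hsb htb hBc hsc htc hab hac hbc ↦
    TPinchPos.three_closed_of_three_open hn hnN hBa hsa hta hBb hsb htb hBc hsc htc hab hac hbc

end Summit.CriticalPhenomena.CardyFormulaZ2.Cruxes.NestingRigidity.PinchResampling
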